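import Mathlib.Topology.Connected.LocallyConnected
import Mathlib.Topology.UniformSpace.HeineCantor
import Literature.Topology.PlaneTopology.HalfLineCurves
import Literature.Topology.PlaneTopology.LocallyConnectedContinua
import Literature.Probability.RandomPlanarGeometry.TwoSidedWholePlaneSLE
import HarnessLib

/-!
# The remaining domain of an arm: point-set topology

Topic `Probability/RandomPlanarGeometry`; support file for `ArmComplementBoundary` (the continuity
theorem for conformal maps onto the remaining domain `Ĉ(η; ∞) = armComplement η` of an arm `η` running
from `∞` to `0`, Pommerenke (1992), Thm 2.1, in the form consumed by
`TwoSidedWholePlaneSLEScalingReduction`). Routine point-set facts, all proved: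

* `Loewner.isOpen_unboundedComponent_of_isOpen`, `Loewner.frontier_unboundedComponent_subset`:
  the union `unboundedComponent U` of the unbounded components of an open set `U ⊆ ℂ` is open, and
  its frontier lies in `ℂ ∖ U` (components of open sets of the locally connected plane are open).
* `isClosed_insert_zero_range`: the closed arm `{0} ∪ η(ℝ)` of a continuous `η : ℝ → ℂ` with
  `η(+∞) = 0` and `η(-∞) = ∞` is closed (a compact half `{0} ∪ η([0, ∞))`,
  `Literature.Topology.PlaneTopology.isCompact_insert_image_Ici`, and a half `η((-∞, 0])` that is
  closed because `η` is proper on it).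
* `Literature.Topology.PlaneTopology.IsUniformlyLocallyConnected.image_of_isCompact`: the image of a
  compact uniformly locally connected set under a continuous injective map is uniformly locally
  connected (uniform continuity of the map and of its inverse on a compact set).

## References

* Ch. Pommerenke, *Boundary Behaviour of Conformal Maps* (1992), §2.2. [PommerenkeBBCM1992]
-/

noncomputable section

open Set Filter Topology Metric Bornology

namespace Literature.Probability.RandomPlanarGeometry

/-! ### Unbounded components of an open set -/

namespace Loewner

/-- The union of the unbounded components of an OPEN set `U ⊆ ℂ` is open: with a point it contains
its (open) connected component in `U`. [folklore] -/
theorem isOpen_unboundedComponent_of_isOpen {U : Set ℂ} (hU : IsOpen U) :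
    IsOpen (unboundedComponent U) := by
  rw [isOpen_iff_mem_nhds]
  rintro z ⟨hzU, hzb⟩
  refine mem_of_superset (hU.connectedComponentIn.mem_nhds (mem_connectedComponentIn hzU)) ?_
  intro y hy
  refine ⟨connectedComponentIn_subset _ _ hy, ?_⟩
  rwa [← connectedComponentIn_eq hy]

/-- The frontier of the union of the unbounded components of an open set `U ⊆ ℂ` lies in `ℂ ∖ U`:
a frontier point inside `U` would have its (open) component meet, hence be, an unbounded component.
[folklore] -/
theorem frontier_unboundedComponent_subset {U : Set ℂ} (hU : IsOpen U) :
    frontier (unboundedComponent U) ⊆ Uᶜ := by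
  intro x hx hxU
  have hxcl : x ∈ closure (unboundedComponent U) := frontier_subset_closure hx
  -- the component of `x` meets the unbounded part
  obtain ⟨y, hyC, hyD⟩ : (connectedComponentIn U x ∩ unboundedComponent U).Nonempty :=
    mem_closure_iff_nhds.1 hxcl _ (hU.connectedComponentIn.mem_nhds (mem_connectedComponentIn hxU))
  have hxD : x ∈ unboundedComponent U := by
    refine ⟨hxU, fun hb ↦ hyD.2 ?_⟩
    rwa [← connectedComponentIn_eq hyC]
  -- but an open set does not meet its frontier
  have : x ∈ unboundedComponent U ∩ frontier (unboundedComponent U) := ⟨hxD, hx⟩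
  rw [(isOpen_unboundedComponent_of_isOpen hU).inter_frontier_eq] at this
  exact this

end Loewner

/-! ### The closed arm -/

/-- **The closed arm is closed.** For a continuous `η : ℝ → ℂ` with `η(t) → 0` as `t → +∞` and
`η(t) → ∞` as `t → -∞`, the set `{0} ∪ η(ℝ)` is closed: `{0} ∪ η([0, ∞))` is compact (a half-line
curve closed up by its limit), and `η((-∞, 0])` is closed since near any point only a compact piece
`η([T, 0])` of it can accumulate. [folklore] -/
theorem isClosed_insert_zero_range {η : ℝ → ℂ} (hc : Continuous η)
    (htop : Tendsto η atTop (𝓝 0)) (hbot : Tendsto η atBot (cocompact ℂ)) :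
    IsClosed (insert (0 : ℂ) (range η)) := by
  have hsplit : insert (0 : ℂ) (range η) = insert 0 (η '' Ici 0) ∪ η '' Iic 0 := by
    rw [insert_union, ← image_union, union_comm, Iic_union_Ici, image_univ]
  rw [hsplit]
  refine ((Literature.Topology.PlaneTopology.isCompact_insert_image_Ici hc.continuousOn
    htop).isClosed).union (isClosed_of_closure_subset fun z hz ↦ ?_)
  -- beyond some `T ≤ 0` the arm stays outside `closedBall z 1`
  have hev : ∀ᶠ t in atBot, η t ∈ (closedBall z 1)ᶜ := hbot (isCompact_closedBall z 1).compl_mem_cocompact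
  obtain ⟨T, hT⟩ := eventually_atBot.1 hev
  have hT' : ∀ t ≤ min T 0, η t ∉ closedBall z 1 := fun t ht ↦ hT t (ht.trans (min_le_left _ _))
  have hsplit2 : η '' Iic 0 = η '' Icc (min T 0) 0 ∪ η '' Iic (min T 0) := by
    rw [← image_union, union_comm, Iic_union_Icc_eq_Iic (min_le_right T 0)]
  rw [hsplit2, closure_union] at hz
  rcases hz with hz | hz
  · rw [(isCompact_Icc.image hc).isClosed.closure_eq] at hz
    exact image_mono Icc_subset_Iic_self hz
  · exfalso
    obtain ⟨_, ⟨t, ht, rfl⟩, hd⟩ := Metric.mem_closure_iff.1 hz 1 one_pos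
    exact hT' t ht (mem_closedBall.2 (by rw [dist_comm]; exact hd.le))

/-! ### Images of uniformly locally connected compact sets -/

/-- **A continuous injective image of a compact uniformly locally connected set is uniformly locally
connected** (in the sense of `Literature.Topology.PlaneTopology.IsUniformlyLocallyConnected`): small
continua are pushed forward, with the moduli controlled by the uniform continuity of the map on the
compact set and of its inverse (pairs at distance `≥ δ₁` have images at distance bounded below, by
compactness and injectivity). Pommerenke (1992), §2.2. [folklore] -/
theorem isUniformlyLocallyConnected_image_of_isCompact {X Y : Type*} [MetricSpace X] [MetricSpace Y]
    {K : Set X} (hK : Literature.Topology.PlaneTopology.IsUniformlyLocallyConnected K)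
    (hKc : IsCompact K) {f : X → Y} (hf : ContinuousOn f K) (hinj : InjOn f K) :
    Literature.Topology.PlaneTopology.IsUniformlyLocallyConnected (f '' K) := by
  intro ε hε
  -- uniform continuity of `f` on `K`
  obtain ⟨ε₁, hε₁, hf₁⟩ : ∃ ε₁ > 0, ∀ x ∈ K, ∀ y ∈ K, dist x y < ε₁ → dist (f x) (f y) < ε := by
    have huc := hKc.uniformContinuousOn_of_continuous hf
    rw [Metric.uniformContinuousOn_iff] at huc
    exact huc ε hε
  obtain ⟨δ₁, hδ₁, hK₁⟩ := hK (ε₁ / 2) (half_pos hε₁)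
  -- uniform continuity of the inverse
  obtain ⟨δ, hδ, hinv⟩ : ∃ δ > 0, ∀ x ∈ K, ∀ y ∈ K, dist (f x) (f y) < δ → dist x y < δ₁ := by
    set S : Set (X × X) := (K ×ˢ K) ∩ {q : X × X | δ₁ ≤ dist q.1 q.2} with hS_def
    have hSc : IsCompact S := (hKc.prod hKc).inter_right (isClosed_le continuous_const continuous_dist)
    rcases S.eq_empty_or_nonempty with hS | hS
    · refine ⟨1, one_pos, fun x hx y hy _ ↦ ?_⟩
      by_contra h
      have : (x, y) ∈ S := ⟨⟨hx, hy⟩, not_lt.1 h⟩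
      rw [hS] at this
      exact this
    · have h1 : ContinuousOn (fun q : X × X ↦ f q.1) S :=
        hf.comp continuousOn_fst fun q (hq : q ∈ S) ↦ hq.1.1
      have h2 : ContinuousOn (fun q : X × X ↦ f q.2) S :=
        hf.comp continuousOn_snd fun q (hq : q ∈ S) ↦ hq.1.2
      have hgc : ContinuousOn (fun q : X × X ↦ dist (f q.1) (f q.2)) S :=
        continuous_dist.comp_continuousOn (h1.prodMk h2)
      obtain ⟨q₀, hq₀, hmin⟩ := hSc.exists_isMinOn hS hgc
      refine ⟨dist (f q₀.1) (f q₀.2), ?_, fun x hx y hy hxy ↦ ?_⟩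
      · refine dist_pos.2 fun heq ↦ ?_
        have h12 : q₀.1 = q₀.2 := hinj hq₀.1.1 hq₀.1.2 heq
        have hd : δ₁ ≤ dist q₀.1 q₀.2 := hq₀.2
        rw [h12, dist_self] at hd
        exact absurd hd (not_le.2 hδ₁)
      · by_contra h
        have hmem : (x, y) ∈ S := ⟨⟨hx, hy⟩, not_lt.1 h⟩
        exact absurd (isMinOn_iff.1 hmin (x, y) hmem) (not_le.2 hxy)
  refine ⟨δ, hδ, ?_⟩
  rintro _ ⟨a, ha, rfl⟩ _ ⟨b, hb, rfl⟩ hab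
  obtain ⟨σ, hσK, hσc, hσp, haσ, hbσ, hσball⟩ := hK₁ a ha b hb (hinv a ha b hb hab)
  refine ⟨f '' σ, image_mono hσK, hσc.image_of_continuousOn (hf.mono hσK),
    hσp.image f (hf.mono hσK), mem_image_of_mem f haσ, mem_image_of_mem f hbσ, ?_⟩
  rintro _ ⟨x, hx, rfl⟩
  have hxa : dist x a < ε₁ := (mem_closedBall.1 (hσball hx)).trans_lt (half_lt_self hε₁)
  exact mem_closedBall.2 (hf₁ x (hσK hx) a ha hxa).le

end Literature.Probability.RandomPlanarGeometry
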